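import Literature.NumberTheory.Sieve.Maynard2016Lemma7PatternBound
import Literature.NumberTheory.Sieve.Maynard2016Lemma7ClassError
import Literature.NumberTheory.LFunctions.MertensFromChebyshev

/-!
# Maynard (2016), Lemma 7 — the congruence-class moment `Lemma7ClassMoment`

J. Maynard, *Large gaps between primes*, Ann. of Math. 183 (2016), §6, proof of Lemma 7, the
paragraph before (6.33): the sums `Σ_{q ∈ 𝓘, q ≡ c (mod p)} (Σ_{d,e} λ_{d,e})²` over ONE class of `q`
modulo a mid prime `w < p ≤ y` carry only the fraction `≪_k 1/p` of the main term, so that the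
correction `Σ_{(a,b)} Σ_{w<p≤y, p∤m} p⁻¹ Σ_{q : p ∣ m q (h_b−h_a) − 1} (…)²` (`classCorr`) is
`o(main term) + O_A(x (log x)^{−A})`.  This file proves the named fact
`Maynard2016.Lemma7ClassMoment` of `Maynard2016Lemma7Assembly` (`lemma7ClassMoment_holds`), closing
the last input of `lemma7Tuple_of_parts` besides `lemma7MainLower_holds`.

Route (finite probability model, `Maynard2016Lemma7ProbModel` … `Maynard2016Lemma7PatternBound`):
per prime `p` and class `c`, `Σ_{q ≡ c} = N · Q_p(λ) + (error)` (`Maynard2016Lemma7ClassSplit`);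
`Q_p(λ) ≤ (2·4^k/(p−1)) Σ_{S,T} Q(W_{S,T})` for `p ≤ y^{1−δ}` with the smooth translated weights
`W_{S,T}`, each `Q(W_{S,T}) ≪ 𝔖 N⁷/(log x log y)^{k−1}` uniformly (`Maynard2016Lemma7PatternBound`),
and `Q_p(λ) ≤ Q(λ)` on the window `y^{1−δ} < p ≤ y` whose `Σ 1/p` is `O(δ)`; `Σ_{p>w} 1/(p(p−1)) → 0`;
the error terms are Bombieri–Vinogradov (`Maynard2016Lemma7ClassError`).

* `classFilter_dichotomy` — `{q : p ∣ a q − 1}` is empty or a class `q ≡ c (p)`, `c ∈ unitsR p`;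
* `exists_eventually_abs_Qform_smoothWt_le` — the uniform bound for `Q(W_{S,T})`;
* `sum_Ioc_inv_mul_inv_sub_one_le`, `sum_inv_primes_rpow_window_le`, `eventually_log_y_ge` — growth;
* `lemma7ClassMoment_holds`.

## References

* J. Maynard, *Large gaps between primes*, Ann. of Math. (2) 183 (2016), 915–933; arXiv:1408.5110,
  §6, proof of Lemma 7 (before (6.33)). [Maynard2016LargeGaps]
* K. Ford, *Vinogradov's integral and bounds for the Riemann zeta function*, Proc. LMS 85 (2002)
  (Mertens-type window bound, via `MertensFromChebyshev`). [Ford2002]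
-/

noncomputable section

open Filter Finset Real
open scoped BigOperators Topology

namespace Literature.NumberTheory.Sieve

namespace Maynard2016

open LcmEuler

variable {k J : ℕ}

/-! ### The condition `p ∣ a q − 1` is a class of `q` -/

/-- For a prime `p` and an integer `a`: either no `q` satisfies `p ∣ a q − 1`, or `p ∤ a` and the
condition is `q ≡ c (mod p)` with `c = a⁻¹ mod p ∈ unitsR p`.
[cite: Maynard2016LargeGaps, Lemma 7 (proof, before (6.33))] -/
theorem classFilter_dichotomy {p : ℕ} (hp : p.Prime) (a : ℤ) :
    (∀ q : ℕ, ¬ (p : ℤ) ∣ a * q - 1) ∨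
      ∃ c ∈ unitsR p, ∀ q : ℕ, (p : ℤ) ∣ a * q - 1 ↔ q % p = c := by
  by_cases ha : (p : ℤ) ∣ a
  · left
    intro q h
    have h1 : (p : ℤ) ∣ 1 := by
      have := dvd_sub (dvd_mul_of_dvd_left ha (q : ℤ)) h
      simpa using this
    have hp1 : (p : ℤ) ≤ 1 := Int.le_of_dvd one_pos h1
    have := hp.one_lt
    omega
  · right
    haveI := Fact.mk hp
    have ha' : (a : ZMod p) ≠ 0 := by
      rwa [Ne, ZMod.intCast_zmod_eq_zero_iff_dvd]
    set c : ℕ := ((a : ZMod p)⁻¹).val with hcdef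
    have hc : (c : ZMod p) = (a : ZMod p)⁻¹ := ZMod.natCast_zmod_val _
    have hcp : c < p := ZMod.val_lt _
    refine ⟨c, ?_, fun q => ?_⟩
    · rw [mem_unitsR]
      refine ⟨hcp, ?_⟩
      rw [Nat.Prime.coprime_iff_not_dvd hp]
      intro h
      have h1 : (c : ZMod p) = 0 := (ZMod.natCast_eq_zero_iff c p).2 h
      rw [hc] at h1
      exact inv_ne_zero ha' h1
    · have e1 : (p : ℤ) ∣ a * q - 1 ↔ ((a * q - 1 : ℤ) : ZMod p) = 0 :=
        (ZMod.intCast_zmod_eq_zero_iff_dvd _ p).symm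
      rw [e1]
      push_cast
      rw [sub_eq_zero, mul_eq_one_iff_inv_eq₀ ha', ← hc, eq_comm, ZMod.natCast_eq_natCast_iff',
        Nat.mod_eq_of_lt hcp]

/-! ### Congruence of the weights in the cutoffs on `[0, ∞)` -/

/-- `λ̃` only sees the cutoffs on `[0, ∞)` when all coordinates are `≥ 1`.
[cite: Maynard2016LargeGaps, §5 display (5.3)] -/
theorem lamG_congr_of_one_le {c : Fin J → ℝ} {Fd Fd' : Fin k → Fin J → ℝ → ℝ}
    {Gs Gs' : Fin k → ℝ → ℝ} (hF : ∀ ℓ j t, 0 ≤ t → Fd' ℓ j t = Fd ℓ j t)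
    (hG : ∀ ℓ t, 0 ≤ t → Gs' ℓ t = Gs ℓ t) {ε : ℝ} {x : ℕ} (hlogx : 0 ≤ Real.log x)
    (hlogy : 0 ≤ Real.log (y ε x)) {d e : Fin k → ℕ} (hd : ∀ ℓ, 1 ≤ d ℓ) (he : ∀ ℓ, 1 ≤ e ℓ) :
    lamG c Fd' Gs' ε x d e = lamG c Fd Gs ε x d e := by
  unfold lamG
  congr 1
  refine Finset.sum_congr rfl fun j _ => ?_
  congr 1
  refine Finset.prod_congr rfl fun ℓ _ => ?_
  have hd' : (1 : ℝ) ≤ d ℓ := by exact_mod_cast hd ℓ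
  have he' : (1 : ℝ) ≤ e ℓ := by exact_mod_cast he ℓ
  rw [hF ℓ j _ (div_nonneg (Real.log_nonneg hd') hlogx),
    hG ℓ _ (div_nonneg (Real.log_nonneg he') hlogy)]

/-- The smooth weight with `p = 1`, `S = T = ∅` (no translation) and left-cut data is `λ · [rbox²]`.
[cite: Maynard2016LargeGaps, Lemma 7 (proof, before (6.33))] -/
theorem smoothWt_one_empty_eq {c : Fin J → ℝ} {Fd : Fin k → Fin J → ℝ → ℝ} {G : ℝ → ℝ}
    {δ : ℝ} (hδ : 0 < δ) {ε : ℝ} {x : ℕ} (hlogx : 0 < Real.log x) (hlogy : 0 < Real.log (y ε x))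
    (i : Fin k) :
    smoothWt c (cutF δ Fd) (fun _ => cutLeftD δ G) ε x i
        ((-1) ^ ((∅ : Finset (Fin k)).card + (∅ : Finset (Fin k)).card)) (sigmaP 1 x ∅)
        (tauP 1 ε x ∅) =
      fun d e => if d ∈ rbox k x i ∧ e ∈ rbox k x i then lam c Fd G ε x d e else 0 := by
  funext d e
  unfold smoothWt
  by_cases h : d ∈ rbox k x i ∧ e ∈ rbox k x i
  · rw [if_pos h, if_pos h]
    simp only [Finset.card_empty, add_zero, pow_zero, one_mul]
    have hbd := fun ℓ => (Finset.mem_Icc.1 (Fintype.mem_piFinset.1 (mem_rbox.1 h.1).1 ℓ)).1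
    have hbe := fun ℓ => (Finset.mem_Icc.1 (Fintype.mem_piFinset.1 (mem_rbox.1 h.2).1 ℓ)).1
    rw [lam_eq_lamG]
    refine lamG_congr_of_one_le (fun ℓ j t ht => ?_) (fun ℓ t ht => ?_) hlogx.le hlogy.le hbd hbe
    · simp only [trF, sigmaP, Finset.notMem_empty, if_false, add_zero]
      exact cutF_eq hδ Fd ℓ j ht
    · simp only [trG, tauP, Finset.notMem_empty, if_false, add_zero]
      exact cutLeftD_eq hδ G ht
  · rw [if_neg h, if_neg h]

/-! ### The uniform bound for the quadratic form of a smooth translated weight -/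

/-- `‖Σ_j Σ_{j'} a_{jj'} b_{jj'}‖ ≤ Σ_j Σ_{j'} ‖a_{jj'}‖ ‖b_{jj'}‖`. [folklore] -/
private theorem norm_sum_sum_mul_le (a b : Fin J → Fin J → ℂ) :
    ‖∑ j, ∑ j', a j j' * b j j'‖ ≤ ∑ j, ∑ j', ‖a j j'‖ * ‖b j j'‖ := by
  refine (norm_sum_le _ _).trans (Finset.sum_le_sum fun j _ => ?_)
  refine (norm_sum_le _ _).trans (Finset.sum_le_sum fun j' _ => ?_)
  rw [norm_mul]

/-- **Uniform bound for `Q(W_{S,T})`**: for sieve data, `0 < ε ≤ 1/2`, `0 < δ ≤ 1` there is `C ≥ 0`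
with, for all large `x`, all `1 ≤ m ≤ x`, primes `x < p₀ ≤ x²` with `(m p₀ − 1, P_y) = 1`, every
`p` with `log p ≤ (1−δ) log y` and every pattern `(S, T)` not containing `i`:
`(log x)^{k−1} (log y)^{k−1} |Q(W_{S,T}, W_{S,T})| ≤ C · 𝔖_small^{(k−1)} N⁷`, where `W_{S,T}` is the
smooth weight of the left-cut data translated by `([ℓ∈S] log p/log x, [ℓ∈T] log p/log y)`.
[cite: Maynard2016LargeGaps, Lemma 7 (proof, before (6.33)); Lemma 6 (proof, (6.12)–(6.13))] -/
theorem exists_eventually_abs_Qform_smoothWt_le {c : Fin J → ℝ} {Fd : Fin k → Fin J → ℝ → ℝ}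
    {G : ℝ → ℝ} (hD : IsSieveData k J c Fd G) (i : Fin k) {ε : ℝ} (hε0 : 0 < ε) (hε : ε ≤ 1 / 2)
    {δ : ℝ} (hδ0 : 0 < δ) (hδ1 : δ ≤ 1) :
    ∃ C : ℝ, 0 ≤ C ∧ ∀ᶠ x : ℕ in atTop, ∀ m p₀ : ℕ, 1 ≤ m → m ≤ x → p₀.Prime → x < p₀ →
      (p₀ : ℝ) ≤ (x : ℝ) ^ 2 → Nat.Coprime (m * p₀ - 1) (primorial ⌊y ε x⌋₊) →
      ∀ p : ℕ, Real.log p ≤ (1 - δ) * Real.log (y ε x) → ∀ S T : Finset (Fin k), i ∉ S → i ∉ T →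
        (Real.log x) ^ (k - 1) * (Real.log (y ε x)) ^ (k - 1) *
            |Qform k x m p₀ i
              (smoothWt c (cutF δ Fd) (fun _ => cutLeftD δ G) ε x i ((-1) ^ (S.card + T.card))
                (sigmaP p x S) (tauP p ε x T))
              (smoothWt c (cutF δ Fd) (fun _ => cutLeftD δ G) ε x i ((-1) ^ (S.card + T.card))
                (sigmaP p x S) (tauP p ε x T))| ≤
          C * (singSmall (k - 1) x * nuProd7 k x m p₀ i) := by
  obtain ⟨C₀, hC₀0, hC₀⟩ := eventually_norm_logpow_mul_patternSum_le hD i hε0 hε hδ0 hδ1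
  -- the constant `B = Σ_j Σ_j' |c_j c_j' F_{i,j}(0) F_{i,j'}(0)| G(0)²`
  set B : ℝ := ∑ j, ∑ j', ‖(c j : ℂ) * c j' * ((Fd i j 0 : ℂ) * Fd i j' 0 * G 0 * G 0)‖ with hB
  have hB0 : 0 ≤ B := Finset.sum_nonneg fun j _ => Finset.sum_nonneg fun j' _ => norm_nonneg _
  refine ⟨B * C₀, mul_nonneg hB0 hC₀0, ?_⟩
  have h1x : ∀ᶠ x : ℕ in atTop, 1 ≤ x := eventually_ge_atTop 1
  filter_upwards [hC₀, eventually_prime_dvd_Pw_of_dvd_hTuple_sub k, eventually_iteratedLogs, h1x]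
    with x hx hPw hlogs hx1 m p₀ hm hmx hp₀ hxp hp₀x hcop p hp S T hiS hiT
  obtain ⟨hL, hL₂, hL₃, -, hL₂L, -, -⟩ := hlogs
  have hlogx : 0 < Real.log x := by linarith
  have hlogy : 0 < Real.log (y ε x) := log_y_pos hε (by linarith) (by linarith) hL₃
  have hW : ∀ a b : Fin k, a ≠ b → ∀ q : ℕ, q.Prime →
      (q : ℤ) ∣ (hTuple k x b : ℤ) - hTuple k x a → q ∣ Pw x :=
    fun a b hab q hq hdvd => hPw a b hab q hq hdvd
  have hA : AdmWt k m p₀ (smoothWt c (cutF δ Fd) (fun _ => cutLeftD δ G) ε x i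
      ((-1) ^ (S.card + T.card)) (sigmaP p x S) (tauP p ε x T)) :=
    admWt_lamG_tr (hD.suppG_cut hδ0) (sigmaP_nonneg p hlogx S) (tauP_nonneg p hlogy T) hx1 hlogx
      hlogy hxp hcop i _
  have hQ := ofReal_Qform_smoothWt_eq (c := c) (Fd := cutF δ Fd) (Gs := fun _ => cutLeftD δ G)
    (ε := ε) hx1 hp₀ hm hW hA
  -- the values at `0`
  have hFi : ∀ j, trF (sigmaP p x S) (cutF δ Fd) i j 0 = Fd i j 0 := by
    intro j
    simp only [trF, sigmaP, if_neg hiS, add_zero]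
    exact cutF_eq hδ0 Fd i j le_rfl
  have hGi : trG (tauP p ε x T) (fun _ => cutLeftD δ G) i 0 = G 0 := by
    simp only [trG, tauP, if_neg hiT, add_zero]
    exact cutLeftD_eq hδ0 G le_rfl
  simp only [hFi, hGi] at hQ
  -- abbreviations
  set Lc : ℂ := (Real.log x : ℂ) ^ (k - 1) * (Real.log (y ε x) : ℂ) ^ (k - 1) with hLc
  set Sj : Fin J → Fin J → ℂ := fun j j' =>
    coupledLcmSumW phiInv (Pw x) m (restrictPairs i i (couplingSet7 k x m p₀ i))
      (fun l : {l : Fin k // l ≠ i} => trF (sigmaP p x S) (cutF δ Fd) l.1 j)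
      (fun l => trF (sigmaP p x S) (cutF δ Fd) l.1 j')
      (fun l => trG (tauP p ε x T) (fun _ => cutLeftD δ G) l.1)
      (fun l => trG (tauP p ε x T) (fun _ => cutLeftD δ G) l.1) (x : ℝ) (y ε x) x with hSj
  have hS : ∀ j j', ‖Lc * Sj j j'‖ ≤ C₀ * (singSmall (k - 1) x * nuProd7 k x m p₀ i) :=
    fun j j' => hx m p₀ hm hmx hxp hp₀x p hp S T j j'
  -- the left-hand side as a norm
  set Q : ℝ := Qform k x m p₀ i
      (smoothWt c (cutF δ Fd) (fun _ => cutLeftD δ G) ε x i ((-1) ^ (S.card + T.card))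
        (sigmaP p x S) (tauP p ε x T))
      (smoothWt c (cutF δ Fd) (fun _ => cutLeftD δ G) ε x i ((-1) ^ (S.card + T.card))
        (sigmaP p x S) (tauP p ε x T)) with hQdef
  have hlhs : (Real.log x) ^ (k - 1) * (Real.log (y ε x)) ^ (k - 1) * |Q| = ‖Lc * (Q : ℂ)‖ := by
    rw [norm_mul, hLc, norm_mul, norm_pow, norm_pow, Complex.norm_real, Complex.norm_real,
      Complex.norm_real, Real.norm_of_nonneg hlogx.le, Real.norm_of_nonneg hlogy.le,
      Real.norm_eq_abs]
  rw [hlhs]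
  have hexp : Lc * (Q : ℂ) = (((-1 : ℝ) ^ (S.card + T.card) : ℝ) : ℂ) ^ 2 *
      ∑ j, ∑ j', ((c j : ℂ) * c j' * ((Fd i j 0 : ℂ) * Fd i j' 0 * G 0 * G 0)) * (Lc * Sj j j') := by
    rw [hQdef, hQ, Finset.mul_sum, Finset.mul_sum, Finset.mul_sum]
    refine Finset.sum_congr rfl fun j _ => ?_
    rw [Finset.mul_sum, Finset.mul_sum, Finset.mul_sum]
    refine Finset.sum_congr rfl fun j' _ => ?_
    simp only [hSj]
    ring
  rw [hexp, norm_mul]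
  have hsgn : ‖((((-1 : ℝ) ^ (S.card + T.card) : ℝ) : ℂ)) ^ 2‖ = 1 := by
    rw [norm_pow, Complex.norm_real, norm_pow, norm_neg, norm_one, one_pow, one_pow]
  rw [hsgn, one_mul]
  refine (norm_sum_sum_mul_le _ _).trans ?_
  calc ∑ j, ∑ j', ‖(c j : ℂ) * c j' * ((Fd i j 0 : ℂ) * Fd i j' 0 * G 0 * G 0)‖ * ‖Lc * Sj j j'‖
      ≤ ∑ j, ∑ j', ‖(c j : ℂ) * c j' * ((Fd i j 0 : ℂ) * Fd i j' 0 * G 0 * G 0)‖ *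
          (C₀ * (singSmall (k - 1) x * nuProd7 k x m p₀ i)) :=
        Finset.sum_le_sum fun j _ => Finset.sum_le_sum fun j' _ =>
          mul_le_mul_of_nonneg_left (hS j j') (norm_nonneg _)
    _ = B * C₀ * (singSmall (k - 1) x * nuProd7 k x m p₀ i) := by
        rw [hB, Finset.sum_mul, Finset.sum_mul]
        refine Finset.sum_congr rfl fun j _ => ?_
        rw [Finset.sum_mul, Finset.sum_mul]
        refine Finset.sum_congr rfl fun j' _ => ?_
        ring

/-! ### Growth lemmas -/

/-- `Σ_{a < n ≤ b} 1/(n(n−1)) ≤ 1/a` for `a ≥ 1` (telescoping). [folklore] -/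
private theorem sum_Ioc_inv_mul_inv_sub_one_le {a : ℕ} (ha : 1 ≤ a) (b : ℕ) :
    ∑ n ∈ Finset.Ioc a b, (1 : ℝ) / ((n : ℝ) * ((n : ℝ) - 1)) ≤ 1 / a := by
  rcases le_or_gt a b with hab | hab
  · obtain ⟨t, rfl⟩ := Nat.exists_eq_add_of_le hab
    have key : ∀ t : ℕ, ∑ n ∈ Finset.Ioc a (a + t), (1 : ℝ) / ((n : ℝ) * ((n : ℝ) - 1)) =
        1 / a - 1 / ((a + t : ℕ) : ℝ) := by
      intro t
      induction t with
      | zero => simp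
      | succ t ih =>
        rw [← add_assoc, Finset.sum_Ioc_succ_top (by omega), ih]
        have ha0 : (0 : ℝ) < a := by exact_mod_cast ha
        have h1 : (0 : ℝ) < ((a + t : ℕ) : ℝ) := by positivity
        push_cast at h1 ⊢
        have h2 : ((a : ℝ) + t + 1) * ((a : ℝ) + t + 1 - 1) = ((a : ℝ) + t + 1) * ((a : ℝ) + t) := by
          ring
        have h3 : (1 : ℝ) / (((a : ℝ) + t + 1) * ((a : ℝ) + t)) = 1 / ((a : ℝ) + t) - 1 / ((a : ℝ) + t + 1) := by
          rw [div_sub_div _ _ h1.ne' (by linarith : (a : ℝ) + t + 1 ≠ 0)]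
          ring
        rw [h2, h3]
        ring
    rw [key]
    have : (0 : ℝ) ≤ 1 / ((a + t : ℕ) : ℝ) := by positivity
    linarith
  · rw [Finset.Ioc_eq_empty (by omega), Finset.sum_empty]
    positivity

/-- `Σ_{w < p ≤ y} 1/(p(p−1)) ≤ 1/⌊w⌋` (`⌊w⌋ ≥ 1`). [cite: Maynard2016LargeGaps, Lemma 7 (proof, before (6.33))] -/
theorem sum_midPrimes_inv_mul_le {ε : ℝ} {x : ℕ} (hw : 1 ≤ ⌊wFun x⌋₊) :
    ∑ p ∈ midPrimes ε x, (1 : ℝ) / ((p : ℝ) * ((p : ℝ) - 1)) ≤ 1 / ⌊wFun x⌋₊ := by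
  unfold midPrimes
  refine (Finset.sum_le_sum_of_subset_of_nonneg (Finset.filter_subset _ _) fun n hn _ => ?_).trans
    (sum_Ioc_inv_mul_inv_sub_one_le hw _)
  have h2 : (2 : ℝ) ≤ n := by
    have := (Finset.mem_Ioc.1 hn).1
    exact_mod_cast (show 2 ≤ n by omega)
  have : (0 : ℝ) ≤ (n : ℝ) * ((n : ℝ) - 1) := by nlinarith
  positivity

/-- **The window `y^{1−δ} < p ≤ y`**: for `Y ≥ 1`, `0 ≤ δ ≤ 1/2`, `M ≥ 10` and `e^M ≤ Y^{1−δ}`,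
`Σ_{Y^{1−δ} < p ≤ Y} 1/p ≤ 2.1444 δ + 25/M` (Mertens in Ford's explicit form).
[cite: Ford2002, §2; Maynard2016LargeGaps, Lemma 7 (proof, before (6.33))] -/
theorem sum_inv_primes_rpow_window_le {Y δ M : ℝ} (hY1 : 1 ≤ Y) (hδ0 : 0 ≤ δ) (hδ : δ ≤ 1 / 2)
    (hM : 10 ≤ M) (hMY : Real.exp M ≤ Y ^ (1 - δ)) :
    ∑ p ∈ (Finset.Ioc ⌊Y ^ (1 - δ)⌋₊ ⌊Y⌋₊).filter Nat.Prime, (1 : ℝ) / p ≤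
      2.1444 * δ + 25 / M := by
  have hY0 : 0 < Y := by linarith
  have h10 : Real.exp 10 ≤ Y ^ (1 - δ) := (Real.exp_le_exp.2 hM).trans hMY
  have hYd : Y ^ (1 - δ) ≤ Y := by
    conv_rhs => rw [← Real.rpow_one Y]
    exact Real.rpow_le_rpow_of_exponent_le hY1 (by linarith)
  have h := Literature.NumberTheory.LFunctions.MertensChebyshev.sum_inv_primes_window_le h10 hYd
  have hYd0 : 0 < Y ^ (1 - δ) := Real.rpow_pos_of_pos hY0 _
  have hlogYd : Real.log (Y ^ (1 - δ)) = (1 - δ) * Real.log Y := Real.log_rpow hY0 _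
  have hM0 : 0 < M := by linarith
  have hlogYd_ge : M ≤ Real.log (Y ^ (1 - δ)) := by
    rw [Real.le_log_iff_exp_le hYd0]; exact hMY
  have hlogY : 0 < Real.log Y := by
    have h1 : 0 < (1 - δ) * Real.log Y := by rw [← hlogYd]; linarith
    exact pos_of_mul_pos_right h1 (by linarith)
  -- term 1
  have hT1 : Real.log (Real.log Y) - Real.log (Real.log (Y ^ (1 - δ))) = -Real.log (1 - δ) := by
    rw [hlogYd, Real.log_mul (by linarith : (1 - δ) ≠ 0) hlogY.ne']; ring
  have hT1' : -Real.log (1 - δ) ≤ 2 * δ := by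
    have h1 : Real.log ((1 - δ)⁻¹) ≤ (1 - δ)⁻¹ - 1 :=
      Real.log_le_sub_one_of_pos (inv_pos.2 (by linarith))
    rw [Real.log_inv] at h1
    have h2 : (1 - δ)⁻¹ - 1 = δ / (1 - δ) := by
      rw [eq_div_iff (by linarith : (1 - δ) ≠ 0), sub_mul, inv_mul_cancel₀ (by linarith)]
      ring
    have h3 : δ / (1 - δ) ≤ 2 * δ := by rw [div_le_iff₀ (by linarith)]; nlinarith
    linarith
  -- term 2
  have hT2 : 0.133 / Real.log (Y ^ (1 - δ)) ≤ 0.133 / M :=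
    div_le_div_of_nonneg_left (by norm_num) hM0 hlogYd_ge
  -- term 3
  have hT3 : 12 / Real.sqrt (Y ^ (1 - δ)) ≤ 24 / M := by
    have h1 : Real.sqrt (Real.exp M) ≤ Real.sqrt (Y ^ (1 - δ)) := Real.sqrt_le_sqrt hMY
    rw [← Real.exp_half] at h1
    have h2 : M / 2 + 1 ≤ Real.exp (M / 2) := Real.add_one_le_exp _
    have h3 : M / 2 ≤ Real.sqrt (Y ^ (1 - δ)) := by linarith
    calc 12 / Real.sqrt (Y ^ (1 - δ)) ≤ 12 / (M / 2) :=
          div_le_div_of_nonneg_left (by norm_num) (by positivity) h3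
      _ = 24 / M := by field_simp; ring
  have h25 : 0.133 / M + 24 / M ≤ 25 / M := by
    rw [← add_div]; exact div_le_div_of_nonneg_right (by norm_num) hM0.le
  rw [hT1] at h
  linarith

/-- `log y → ∞`: any constant is eventually `≤ log y`. [cite: Maynard2016LargeGaps, §2 display (2.1)] -/
theorem eventually_log_y_ge {ε : ℝ} (hε : ε ≤ 1 / 2) (C : ℝ) :
    ∀ᶠ x : ℕ in atTop, C ≤ Real.log (y ε x) := by
  filter_upwards [eventually_le_wFun (2 * C + 2), eventually_iteratedLogs] with x hw hlogs
  obtain ⟨hL, hL₂, hL₃, -, hL₂L, -, -⟩ := hlogs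
  have h1 := half_log₃_le_log_y hε (by linarith) (by linarith) (by linarith)
  have h2 : wFun x ≤ Real.log (Real.log (Real.log x)) - 1 := wFun_le (by linarith)
  linarith

/-! ### The class sum: main term plus error, and the two bounds for the main term -/

/-- **Per prime and class**: `Σ_{q ∈ 𝓘, q ≡ c (p)} T(q) ≤ #𝓘 · Q_p(λ·[rbox²]) + Σ_{tuples} |λλ'| 2E*(x; r_p)`.
[cite: Maynard2016LargeGaps, Lemma 7 (proof, displays (6.27)–(6.29) and before (6.33))] -/
theorem classSum_le_main_add_err {c₀ : Fin J → ℝ} {Fd : Fin k → Fin J → ℝ → ℝ} {G : ℝ → ℝ}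
    (hD : IsSieveData k J c₀ Fd G) {ε : ℝ} {x : ℕ} (hx1 : 1 ≤ x) (hlogx : 0 < Real.log x)
    (hlogy : 0 < Real.log (y ε x)) (hyx : y ε x ≤ x) {m p₀ : ℕ} (hm : 1 ≤ m) (hp₀ : p₀.Prime)
    (hxp : x < p₀) (hcop : Nat.Coprime (m * p₀ - 1) (primorial ⌊y ε x⌋₊)) {i : Fin k}
    (hacop : ∀ j, j ≠ i → IsCoprime ((m : ℤ) * p₀ - 1) ((hTuple k x j : ℤ) - hTuple k x i))
    {p c : ℕ} (hp : p.Prime) (hc : c ∈ unitsR p) {A B : ℝ} (hA : 1 ≤ A) (hAB : A ≤ B)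
    (hBX : B ≤ x) (hQ : ∀ q ∈ intervalPrimes A B, hTuple k x i * q < p₀) :
    ∑ q ∈ (intervalPrimes A B).filter (fun q => q % p = c),
        divSum c₀ Fd G ε x m q (p₀ - hTuple k x i * q) ^ 2 ≤
      ((intervalPrimes A B).card : ℝ) *
          QformP p c k x m p₀ i
            (fun d e => if d ∈ rbox k x i ∧ e ∈ rbox k x i then lam c₀ Fd G ε x d e else 0)
            (fun d e => if d ∈ rbox k x i ∧ e ∈ rbox k x i then lam c₀ Fd G ε x d e else 0) +
        ∑ d ∈ rbox k x i, ∑ d' ∈ rbox k x i, ∑ e ∈ rbox k x i, ∑ e' ∈ rbox k x i,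
          |lam c₀ Fd G ε x d e * lam c₀ Fd G ε x d' e'| *
            (2 * primeCountingAPErrMax x (radP p d d' e e')) := by
  have h := abs_sum_filter_divSum_sq_sub_main_le hD hx1 hlogx hlogy hyx hm hp₀ hxp hcop hacop hp hc
    hA hAB (X := x) hBX hQ
  rw [sum_mainCoeffP_eq, ← QformP_restrict] at h
  have := (abs_sub_le_iff.1 h).1
  linarith

/-- **Trivial bound for the class main term**, given the uniform bound for `Q(λ·[rbox²])` in the form
of `exists_eventually_abs_Qform_smoothWt_le` with `p = 1`, `S = T = ∅`, `δ = 1/2`.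
[cite: Maynard2016LargeGaps, Lemma 7 (proof, before (6.33))] -/
theorem logpow_mul_QformP_le_of_trivial {c₀ : Fin J → ℝ} {Fd : Fin k → Fin J → ℝ → ℝ} {G : ℝ → ℝ}
    (hD : IsSieveData k J c₀ Fd G) {ε : ℝ} {x : ℕ} (hx1 : 1 ≤ x) (hlogx : 0 < Real.log x)
    (hlogy : 0 < Real.log (y ε x)) {m p₀ : ℕ} (hm : 1 ≤ m) (hp₀ : p₀.Prime) (hxp : x < p₀)
    (hcop : Nat.Coprime (m * p₀ - 1) (primorial ⌊y ε x⌋₊)) {i : Fin k}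
    (hacop : ∀ j, j ≠ i → IsCoprime ((m : ℤ) * p₀ - 1) ((hTuple k x j : ℤ) - hTuple k x i))
    {p c : ℕ} (hp : p.Prime) (hc : c ∈ unitsR p) (hpx : p ≤ x) {Ch : ℝ}
    (hbound : (Real.log x) ^ (k - 1) * (Real.log (y ε x)) ^ (k - 1) *
      |Qform k x m p₀ i
        (smoothWt c₀ (cutF (1 / 2) Fd) (fun _ => cutLeftD (1 / 2) G) ε x i
          ((-1) ^ ((∅ : Finset (Fin k)).card + (∅ : Finset (Fin k)).card)) (sigmaP 1 x ∅)
          (tauP 1 ε x ∅))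
        (smoothWt c₀ (cutF (1 / 2) Fd) (fun _ => cutLeftD (1 / 2) G) ε x i
          ((-1) ^ ((∅ : Finset (Fin k)).card + (∅ : Finset (Fin k)).card)) (sigmaP 1 x ∅)
          (tauP 1 ε x ∅))| ≤ Ch * (singSmall (k - 1) x * nuProd7 k x m p₀ i)) :
    (Real.log x) ^ (k - 1) * (Real.log (y ε x)) ^ (k - 1) *
        QformP p c k x m p₀ i
          (fun d e => if d ∈ rbox k x i ∧ e ∈ rbox k x i then lam c₀ Fd G ε x d e else 0)
          (fun d e => if d ∈ rbox k x i ∧ e ∈ rbox k x i then lam c₀ Fd G ε x d e else 0) ≤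
      Ch * (singSmall (k - 1) x * nuProd7 k x m p₀ i) := by
  rw [smoothWt_one_empty_eq (by norm_num : (0 : ℝ) < 1 / 2) hlogx hlogy i] at hbound
  have hAdm := admWt_lam hD hx1 hlogx hlogy (m := m) hxp hcop i
  have h1 := QformP_le_Qform hp hc hpx hp₀ hm hacop hAdm (i := i)
  have hLL : 0 ≤ (Real.log x) ^ (k - 1) * (Real.log (y ε x)) ^ (k - 1) := by positivity
  exact (mul_le_mul_of_nonneg_left (h1.trans (le_abs_self _)) hLL).trans hbound

/-- **Pattern bound for the class main term** (`p ≤ y^{1−δ}`): given the uniform bounds for the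
`Q(W_{S,T})`, `(log x log y)^{k−1} Q_p(λ·[rbox²]) ≤ (2·4^k/(p−1)) · 4^k · C_δ · 𝔖 N⁷`.
[cite: Maynard2016LargeGaps, Lemma 7 (proof, before (6.33))] -/
theorem logpow_mul_QformP_le_of_pattern {c₀ : Fin J → ℝ} {Fd : Fin k → Fin J → ℝ → ℝ} {G : ℝ → ℝ}
    (hD : IsSieveData k J c₀ Fd G) {δ : ℝ} (hδ0 : 0 < δ) {ε : ℝ} {x : ℕ} (hx1 : 1 ≤ x)
    (hlogx : 0 < Real.log x) (hlogy : 0 < Real.log (y ε x)) (hyx : y ε x ≤ x) {m p₀ : ℕ}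
    (hm : 1 ≤ m) (hp₀ : p₀.Prime) (hxp : x < p₀) (hcop : Nat.Coprime (m * p₀ - 1) (primorial ⌊y ε x⌋₊))
    {i : Fin k} (hacop : ∀ j, j ≠ i → IsCoprime ((m : ℤ) * p₀ - 1) ((hTuple k x j : ℤ) - hTuple k x i))
    {p c : ℕ} (hp : p.Prime) (hc : c ∈ unitsR p) (hpx : p ≤ x) (hpk : 4 * (k - 1) ≤ p - 1)
    (hpm : ¬ p ∣ m) (hph : ∀ j, j ≠ i → ¬ (p : ℤ) ∣ (hTuple k x j : ℤ) - hTuple k x i) {Cd : ℝ}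
    (hCd0 : 0 ≤ Cd)
    (hbound : ∀ S T : Finset (Fin k), i ∉ S → i ∉ T →
      (Real.log x) ^ (k - 1) * (Real.log (y ε x)) ^ (k - 1) *
        |Qform k x m p₀ i
          (smoothWt c₀ (cutF δ Fd) (fun _ => cutLeftD δ G) ε x i ((-1) ^ (S.card + T.card))
            (sigmaP p x S) (tauP p ε x T))
          (smoothWt c₀ (cutF δ Fd) (fun _ => cutLeftD δ G) ε x i ((-1) ^ (S.card + T.card))
            (sigmaP p x S) (tauP p ε x T))| ≤ Cd * (singSmall (k - 1) x * nuProd7 k x m p₀ i)) :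
    (Real.log x) ^ (k - 1) * (Real.log (y ε x)) ^ (k - 1) *
        QformP p c k x m p₀ i
          (fun d e => if d ∈ rbox k x i ∧ e ∈ rbox k x i then lam c₀ Fd G ε x d e else 0)
          (fun d e => if d ∈ rbox k x i ∧ e ∈ rbox k x i then lam c₀ Fd G ε x d e else 0) ≤
      (2 * (4 : ℝ) ^ k / (p - 1 : ℝ)) * (4 : ℝ) ^ k * Cd *
        (singSmall (k - 1) x * nuProd7 k x m p₀ i) := by
  classical
  -- the family of admissible extensions
  set W : Finset (Fin k) → Finset (Fin k) → (Fin k → ℕ) → (Fin k → ℕ) → ℝ := fun S T =>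
    if i ∈ S ∨ i ∈ T then fun _ _ => 0 else
      smoothWt c₀ (cutF δ Fd) (fun _ => cutLeftD δ G) ε x i ((-1) ^ (S.card + T.card))
        (sigmaP p x S) (tauP p ε x T) with hWdef
  have hAdm := admWt_lam hD hx1 hlogx hlogy (m := m) hxp hcop i
  have hWadm : ∀ S T, AdmWt k m p₀ (W S T) := by
    intro S T
    simp only [hWdef]
    split_ifs with h
    · exact admWt_zero k m p₀
    · exact admWt_lamG_tr (hD.suppG_cut hδ0) (sigmaP_nonneg p hlogx S) (tauP_nonneg p hlogy T) hx1
        hlogx hlogy hxp hcop i _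
  have hW : ∀ S T, ∀ d ∈ rbox k x i, ∀ e ∈ rbox k x i, pfPart p (W S T) d e =
      patWt k x i p S T
        (fun d e => if d ∈ rbox k x i ∧ e ∈ rbox k x i then lam c₀ Fd G ε x d e else 0) d e := by
    intro S T d hd e he
    simp only [hWdef]
    split_ifs with h
    · rw [pfPart_zero, patWt_eq_zero_of_mem hp h _ hd he]
    · push Not at h
      exact pfPart_smoothWt_eq_patWt (hD.suppG_cut hδ0) (fun ℓ j t ht => cutF_eq hδ0 Fd ℓ j ht)
        (fun t ht => cutLeftD_eq hδ0 G ht) hx1 hlogx hlogy hyx hp h.1 h.2 hd he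
  have h1 := QformP_le_sum_Qform_of_pfPart hp hc hpx hp₀ hm hacop hAdm hpk hpm hph W hWadm hW
  -- each `Q(W S T)` is bounded
  have hQW : ∀ S T, (Real.log x) ^ (k - 1) * (Real.log (y ε x)) ^ (k - 1) *
      Qform k x m p₀ i (W S T) (W S T) ≤ Cd * (singSmall (k - 1) x * nuProd7 k x m p₀ i) := by
    intro S T
    simp only [hWdef]
    split_ifs with h
    · rw [Qform_zero, mul_zero]
      exact mul_nonneg hCd0 (mul_pos (singSmall_pos _ _) (nuProd7_pos k x m p₀ i)).le
    · push Not at h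
      exact (mul_le_mul_of_nonneg_left (le_abs_self _) (by positivity)).trans (hbound S T h.1 h.2)
  have hLL : 0 ≤ (Real.log x) ^ (k - 1) * (Real.log (y ε x)) ^ (k - 1) := by positivity
  have hp2 : (2 : ℝ) ≤ p := by exact_mod_cast hp.two_le
  have hcoef : 0 ≤ 2 * (4 : ℝ) ^ k / (p - 1 : ℝ) := by
    apply div_nonneg (by positivity); linarith
  have hsum : (Real.log x) ^ (k - 1) * (Real.log (y ε x)) ^ (k - 1) *
      ∑ S ∈ (Finset.univ : Finset (Fin k)).powerset, ∑ T ∈ (Finset.univ : Finset (Fin k)).powerset,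
        Qform k x m p₀ i (W S T) (W S T) ≤
      (4 : ℝ) ^ k * Cd * (singSmall (k - 1) x * nuProd7 k x m p₀ i) := by
    rw [Finset.mul_sum]
    calc ∑ S ∈ (Finset.univ : Finset (Fin k)).powerset,
          (Real.log x) ^ (k - 1) * (Real.log (y ε x)) ^ (k - 1) *
            ∑ T ∈ (Finset.univ : Finset (Fin k)).powerset, Qform k x m p₀ i (W S T) (W S T)
        ≤ ∑ S ∈ (Finset.univ : Finset (Fin k)).powerset,
            ∑ T ∈ (Finset.univ : Finset (Fin k)).powerset,
              Cd * (singSmall (k - 1) x * nuProd7 k x m p₀ i) := by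
          refine Finset.sum_le_sum fun S _ => ?_
          rw [Finset.mul_sum]
          exact Finset.sum_le_sum fun T _ => hQW S T
      _ = (4 : ℝ) ^ k * Cd * (singSmall (k - 1) x * nuProd7 k x m p₀ i) := by
          rw [Finset.sum_const, Finset.sum_const, Finset.card_powerset, Finset.card_univ,
            Fintype.card_fin, nsmul_eq_mul, nsmul_eq_mul]
          push_cast
          rw [← mul_assoc, ← mul_pow]
          norm_num
          ring
  calc (Real.log x) ^ (k - 1) * (Real.log (y ε x)) ^ (k - 1) *
        QformP p c k x m p₀ i
          (fun d e => if d ∈ rbox k x i ∧ e ∈ rbox k x i then lam c₀ Fd G ε x d e else 0)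
          (fun d e => if d ∈ rbox k x i ∧ e ∈ rbox k x i then lam c₀ Fd G ε x d e else 0)
      ≤ (Real.log x) ^ (k - 1) * (Real.log (y ε x)) ^ (k - 1) *
          ((2 * (4 : ℝ) ^ k / (p - 1 : ℝ)) *
            ∑ S ∈ (Finset.univ : Finset (Fin k)).powerset,
              ∑ T ∈ (Finset.univ : Finset (Fin k)).powerset, Qform k x m p₀ i (W S T) (W S T)) :=
        mul_le_mul_of_nonneg_left h1 hLL
    _ = (2 * (4 : ℝ) ^ k / (p - 1 : ℝ)) * ((Real.log x) ^ (k - 1) * (Real.log (y ε x)) ^ (k - 1) *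
          ∑ S ∈ (Finset.univ : Finset (Fin k)).powerset,
            ∑ T ∈ (Finset.univ : Finset (Fin k)).powerset, Qform k x m p₀ i (W S T) (W S T)) := by
        ring
    _ ≤ (2 * (4 : ℝ) ^ k / (p - 1 : ℝ)) * ((4 : ℝ) ^ k * Cd *
          (singSmall (k - 1) x * nuProd7 k x m p₀ i)) := mul_le_mul_of_nonneg_left hsum hcoef
    _ = _ := by ring

/-! ### Assembly -/

/-- The numerical closure of the choice of `δ`, `M` and the `w`-threshold. [folklore] -/
private theorem numeric_closure {k : ℕ} (hk : 2 ≤ k) {η Ch Cd δ M W : ℝ} (hη : 0 < η)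
    (hCh0 : 0 ≤ Ch) (hCd0 : 0 ≤ Cd) (_hδ0 : 0 ≤ δ)
    (hδη : δ ≤ η / (10 * (k : ℝ) ^ 2 * (Ch + 1))) (hMη : 100 * (k : ℝ) ^ 2 * (Ch + 1) / η ≤ M)
    (hW : 4 * (k : ℝ) ^ 2 * 16 ^ k * Cd / η + 4 * k + 1 ≤ W) :
    2 * (16 : ℝ) ^ k * Cd * (1 / W) + Ch * (2.1444 * δ + 25 / M) ≤ η / (k : ℝ) ^ 2 := by
  have hk0 : (0 : ℝ) < k := by exact_mod_cast (show 0 < k by omega)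
  have hkne : (k : ℝ) ≠ 0 := hk0.ne'
  have hk2 : (0 : ℝ) < (k : ℝ) ^ 2 := by positivity
  have hW0 : 0 < W := by
    have : (0 : ℝ) ≤ 4 * (k : ℝ) ^ 2 * 16 ^ k * Cd / η := by positivity
    linarith
  have hM0 : 0 < M := lt_of_lt_of_le (by positivity) hMη
  -- the small-`p` range
  have a0 : 2 * (16 : ℝ) ^ k * Cd * (1 / W) ≤ η / (k : ℝ) ^ 2 / 2 := by
    rw [mul_one_div, div_le_iff₀ hW0, div_div, div_mul_eq_mul_div, le_div_iff₀ (by positivity)]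
    have h1 : η * (4 * (k : ℝ) ^ 2 * 16 ^ k * Cd / η) = 4 * (k : ℝ) ^ 2 * 16 ^ k * Cd :=
      mul_div_cancel₀ _ hη.ne'
    have h2 := mul_le_mul_of_nonneg_left hW hη.le
    nlinarith
  -- the window
  have a1 : Ch * δ ≤ η / (k : ℝ) ^ 2 / 10 := by
    have h1 : Ch * δ ≤ Ch * (η / (10 * (k : ℝ) ^ 2 * (Ch + 1))) := mul_le_mul_of_nonneg_left hδη hCh0
    have h2 : Ch * (η / (10 * (k : ℝ) ^ 2 * (Ch + 1))) ≤ η / (k : ℝ) ^ 2 / 10 := by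
      rw [← mul_div_assoc, div_le_iff₀ (by positivity)]
      have : η / (k : ℝ) ^ 2 / 10 * (10 * (k : ℝ) ^ 2 * (Ch + 1)) = η * (Ch + 1) := by
        field_simp
      rw [this]; nlinarith
    linarith
  have a2 : Ch * (25 / M) ≤ η / (k : ℝ) ^ 2 / 4 := by
    have b1 : 25 / M ≤ 25 / (100 * (k : ℝ) ^ 2 * (Ch + 1) / η) :=
      div_le_div_of_nonneg_left (by norm_num) (by positivity) hMη
    have b2 : Ch * (25 / (100 * (k : ℝ) ^ 2 * (Ch + 1) / η)) ≤ η / (k : ℝ) ^ 2 / 4 := by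
      rw [div_div_eq_mul_div, ← mul_div_assoc, div_le_iff₀ (by positivity)]
      have : η / (k : ℝ) ^ 2 / 4 * (100 * (k : ℝ) ^ 2 * (Ch + 1)) = 25 * η * (Ch + 1) := by
        field_simp
        ring
      rw [this]; nlinarith
    exact (mul_le_mul_of_nonneg_left b1 hCh0).trans b2
  have a3 : Ch * (2.1444 * δ + 25 / M) = 2.1444 * (Ch * δ) + Ch * (25 / M) := by ring
  rw [a3]
  have : η / (k : ℝ) ^ 2 / 2 + (2.1444 * (η / (k : ℝ) ^ 2 / 10) + η / (k : ℝ) ^ 2 / 4) ≤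
      η / (k : ℝ) ^ 2 := by
    have : 0 ≤ η / (k : ℝ) ^ 2 := by positivity
    nlinarith
  nlinarith

/-- Membership facts for `p ∈ {w < p ≤ y : p prime, p ∤ m}`. [folklore] -/
private theorem midPrime_facts {ε : ℝ} {x m p : ℕ} (hy0 : 0 ≤ y ε x) (hyx : y ε x ≤ x)
    (hp : p ∈ (midPrimes ε x).filter (fun p => ¬ p ∣ m)) :
    p.Prime ∧ ¬ p ∣ m ∧ ⌊wFun x⌋₊ < p ∧ wFun x < p ∧ (p : ℝ) ≤ y ε x ∧ p ≤ x ∧ p ≤ ⌊y ε x⌋₊ := by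
  rw [Finset.mem_filter, midPrimes, Finset.mem_filter, Finset.mem_Ioc] at hp
  obtain ⟨⟨⟨hwp, hpy⟩, hpp⟩, hpm⟩ := hp
  have hpy' : (p : ℝ) ≤ y ε x := (Nat.le_floor_iff hy0).1 hpy
  refine ⟨hpp, hpm, hwp, Nat.lt_of_floor_lt hwp, hpy', ?_, hpy⟩
  exact_mod_cast hpy'.trans hyx

set_option maxHeartbeats 1600000 in
/-- **Maynard (2016), Lemma 7 — the congruence-class moment** (`Lemma7ClassMoment`): for sieve data,
`0 < ε ≤ 1/2`, `A > 0` and `η > 0` there is `C` with, for all large `x` and uniformly in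
`1 ≤ m ≤ x`, `x/2 ≤ A' ≤ B' ≤ x`, primes `x < p₀ ≤ x²` with `(m p₀ − 1, P_y) = 1`, `h_i x < p₀`:
`classCorr ≤ η · #𝓘 · 𝔖^{(k−1)} N⁷ /(log x log y)^{k−1} + C x (log x)^{−A}`.  Together with
`lemma7MainLower_holds` this closes `lemma7Tuple_of_parts`, hence Lemma 7 and Theorem 1 of the paper
(`theorem1_of_lemma7Tuple`).
[cite: Maynard2016LargeGaps, Lemma 7 (proof, before (6.33))] -/
theorem lemma7ClassMoment_holds : Lemma7ClassMoment := by
  intro k J cj Fd G hk hD ε hε0 hε A hA η hη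
  classical
  -- constants
  choose C₁ hC₁0 hC₁ using fun i : Fin k =>
    exists_eventually_abs_Qform_smoothWt_le hD i hε0 hε (δ := 1 / 2) (by norm_num) (by norm_num)
  set Ch : ℝ := ∑ i, C₁ i with hChdef
  have hCh0 : 0 ≤ Ch := Finset.sum_nonneg fun i _ => hC₁0 i
  have hC₁le : ∀ i, C₁ i ≤ Ch := fun i =>
    Finset.single_le_sum (f := C₁) (fun j _ => hC₁0 j) (Finset.mem_univ i)
  have hk0 : (0 : ℝ) < k := by exact_mod_cast (show 0 < k by omega)
  have hkne : (k : ℝ) ≠ 0 := hk0.ne'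
  set δ : ℝ := min (1 / 2) (η / (10 * (k : ℝ) ^ 2 * (Ch + 1))) with hδdef
  have hδ0 : 0 < δ := lt_min (by norm_num) (by positivity)
  have hδh : δ ≤ 1 / 2 := min_le_left _ _
  have hδ1 : δ ≤ 1 := by linarith
  have hδη : δ ≤ η / (10 * (k : ℝ) ^ 2 * (Ch + 1)) := min_le_right _ _
  choose C₂ hC₂0 hC₂ using fun i : Fin k =>
    exists_eventually_abs_Qform_smoothWt_le hD i hε0 hε hδ0 hδ1
  set Cd : ℝ := ∑ i, C₂ i with hCddef
  have hCd0 : 0 ≤ Cd := Finset.sum_nonneg fun i _ => hC₂0 i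
  have hC₂le : ∀ i, C₂ i ≤ Cd := fun i =>
    Finset.single_le_sum (f := C₂) (fun j _ => hC₂0 j) (Finset.mem_univ i)
  set M : ℝ := max 10 (100 * (k : ℝ) ^ 2 * (Ch + 1) / η) with hMdef
  have hM10 : 10 ≤ M := le_max_left _ _
  have hMη : 100 * (k : ℝ) ^ 2 * (Ch + 1) / η ≤ M := le_max_right _ _
  obtain ⟨Ce, hCe⟩ := exists_eventually_classErrorSum_le hD hε0.le hε hA
  refine ⟨(k : ℝ) ^ 2 * Ce, ?_⟩
  filter_upwards [Filter.eventually_all.2 hC₁, Filter.eventually_all.2 hC₂, hCe,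
    eventually_le_wFun (4 * (k : ℝ) ^ 2 * 16 ^ k * Cd / η + 4 * k + 2),
    eventually_log_y_ge hε (2 * M), eventually_iteratedLogs,
    eventually_y_lt_half hε0 (by linarith : ε ≤ 1), eventually_isCoprime_hTuple_sub k hε,
    eventually_coprime_hTuple_sub k, eventually_ge_atTop 2]
    with x hx₁ hx₂ hxe hw hlogyM hlogs hyx2 hIsCop hCopSub hx2
  intro m hm hmx A' B' hA' hAB hBx p₀ hp₀ hxp hp₀x hcop i hix
  obtain ⟨hL, -, -, -, -, hLx, -⟩ := hlogs
  have hx1 : 1 ≤ x := by omega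
  have hx0 : (0 : ℝ) < x := by positivity
  have hx2r : (2 : ℝ) ≤ x := by exact_mod_cast hx2
  have hlogx : 0 < Real.log x := by linarith
  have hlogy : 0 < Real.log (y ε x) := by linarith
  have hy0 : 0 < y ε x := Real.exp_pos _
  have hy1 : 1 ≤ y ε x := by
    by_contra h
    push Not at h
    have := Real.log_nonpos hy0.le h.le
    linarith
  have hyx : y ε x ≤ x := by linarith
  have hA1 : 1 ≤ A' := by linarith
  have hacop : ∀ j, j ≠ i → IsCoprime ((m : ℤ) * p₀ - 1) ((hTuple k x j : ℤ) - hTuple k x i) :=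
    fun j hj => hIsCop m p₀ (by nlinarith [hp₀.one_lt]) hcop i j hj
  have hQ : ∀ q ∈ intervalPrimes A' B', hTuple k x i * q < p₀ := by
    intro q hq
    have hqB := ((mem_intervalPrimes (by linarith : (0 : ℝ) ≤ B')).1 hq).2.2
    have hqx : (q : ℝ) ≤ x := hqB.trans hBx
    have h0 : (0 : ℝ) ≤ hTuple k x i := Nat.cast_nonneg _
    have h1 : ((hTuple k x i * q : ℕ) : ℝ) < p₀ := by
      push_cast
      nlinarith
    exact_mod_cast h1
  -- abbreviations
  set N : ℝ := ((intervalPrimes A' B').card : ℝ) with hNdef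
  have hN0 : 0 ≤ N := Nat.cast_nonneg _
  set SN : ℝ := singSmall (k - 1) x * nuProd7 k x m p₀ i with hSNdef
  have hSN0 : 0 < SN := mul_pos (singSmall_pos _ _) (nuProd7_pos k x m p₀ i)
  set LL : ℝ := (Real.log x) ^ (k - 1) * (Real.log (y ε x)) ^ (k - 1) with hLLdef
  have hLL0 : 0 < LL := by positivity
  set R : ℝ := SN / LL with hRdef
  have hR0 : 0 < R := div_pos hSN0 hLL0
  set err : ℕ → ℝ := fun p => ∑ d ∈ rbox k x i, ∑ d' ∈ rbox k x i, ∑ e ∈ rbox k x i,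
      ∑ e' ∈ rbox k x i, |lam cj Fd G ε x d e * lam cj Fd G ε x d' e'| *
        (2 * primeCountingAPErrMax x (radP p d d' e e')) with herrdef
  have herr0 : ∀ p, 0 ≤ err p := fun p => by
    simp only [herrdef]
    refine Finset.sum_nonneg fun _ _ => Finset.sum_nonneg fun _ _ => Finset.sum_nonneg fun _ _ =>
      Finset.sum_nonneg fun _ _ => mul_nonneg (abs_nonneg _) (mul_nonneg (by norm_num) ?_)
    exact primeCountingAPErrMax_nonneg _ _
  set g : ℕ → ℝ := fun p => if (p : ℝ) ≤ y ε x ^ (1 - δ) then 2 * 16 ^ k * Cd / ((p : ℝ) - 1)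
      else Ch with hgdef
  have hg0 : ∀ p : ℕ, 2 ≤ p → 0 ≤ g p := fun p hp2 => by
    simp only [hgdef]
    split_ifs
    · have : (2 : ℝ) ≤ p := by exact_mod_cast hp2
      exact div_nonneg (by positivity) (by linarith)
    · exact hCh0
  -- the threshold for `⌊w⌋`
  have hwfloor : 4 * (k : ℝ) ^ 2 * 16 ^ k * Cd / η + 4 * k + 1 ≤ ⌊wFun x⌋₊ := by
    have := Nat.lt_floor_add_one (wFun x)
    linarith
  have hw1 : 1 ≤ ⌊wFun x⌋₊ := by
    have : (0 : ℝ) ≤ 4 * (k : ℝ) ^ 2 * 16 ^ k * Cd / η := by positivity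
    exact_mod_cast (show (1 : ℝ) ≤ ⌊wFun x⌋₊ by linarith)
  have hw4k : 4 * k + 1 ≤ ⌊wFun x⌋₊ := by
    have : (0 : ℝ) ≤ 4 * (k : ℝ) ^ 2 * 16 ^ k * Cd / η := by positivity
    exact_mod_cast (show ((4 * k + 1 : ℕ) : ℝ) ≤ ⌊wFun x⌋₊ by push_cast; linarith)
  -- the per-`p` step
  have hstep : ∀ p ∈ (midPrimes ε x).filter (fun p => ¬ p ∣ m), ∀ ab : Fin k × Fin k,
      ∑ q ∈ (intervalPrimes A' B').filter (fun q : ℕ =>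
          (p : ℤ) ∣ (m : ℤ) * q * ((hTuple k x ab.2 : ℤ) - hTuple k x ab.1) - 1),
        divSum cj Fd G ε x m q (p₀ - hTuple k x i * q) ^ 2 ≤ N * (R * g p) + err p := by
    intro p hp ab
    obtain ⟨hpp, hpm, hwp', hwp, hpy, hpx, hpyf⟩ := midPrime_facts hy0.le hyx hp
    have hRHS0 : 0 ≤ N * (R * g p) + err p :=
      add_nonneg (mul_nonneg hN0 (mul_nonneg hR0.le (hg0 p hpp.two_le))) (herr0 p)
    rcases classFilter_dichotomy hpp ((m : ℤ) * ((hTuple k x ab.2 : ℤ) - hTuple k x ab.1)) with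
      hnone | ⟨c, hc, hiff⟩
    · have hempty : (intervalPrimes A' B').filter (fun q : ℕ =>
          (p : ℤ) ∣ (m : ℤ) * q * ((hTuple k x ab.2 : ℤ) - hTuple k x ab.1) - 1) = ∅ :=
        Finset.filter_eq_empty_iff.2 fun q _ => by rw [mul_right_comm]; exact hnone q
      rw [hempty, Finset.sum_empty]
      exact hRHS0
    · have hfilt : (intervalPrimes A' B').filter (fun q : ℕ =>
          (p : ℤ) ∣ (m : ℤ) * q * ((hTuple k x ab.2 : ℤ) - hTuple k x ab.1) - 1) =
          (intervalPrimes A' B').filter (fun q => q % p = c) :=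
        Finset.filter_congr fun q _ => by rw [mul_right_comm]; exact hiff q
      rw [hfilt]
      have h1 := classSum_le_main_add_err hD hx1 hlogx hlogy hyx hm hp₀ hxp hcop hacop hpp hc hA1
        hAB hBx hQ
      have hmain : QformP p c k x m p₀ i
          (fun d e => if d ∈ rbox k x i ∧ e ∈ rbox k x i then lam cj Fd G ε x d e else 0)
          (fun d e => if d ∈ rbox k x i ∧ e ∈ rbox k x i then lam cj Fd G ε x d e else 0) ≤
          R * g p := by
        simp only [hgdef]
        split_ifs with hsmall
        · -- `p ≤ y^{1-δ}`: the pattern bound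
          have hlogp : Real.log p ≤ (1 - δ) * Real.log (y ε x) := by
            rw [← Real.log_rpow hy0]
            exact Real.log_le_log (by exact_mod_cast hpp.pos) hsmall
          have hpk : 4 * (k - 1) ≤ p - 1 := by omega
          have hph : ∀ j, j ≠ i → ¬ (p : ℤ) ∣ (hTuple k x j : ℤ) - hTuple k x i := by
            intro j hj hdvd
            have h2 := hCopSub i j (Ne.symm hj) p (coprime_Pw_of_prime_gt hpp hwp)
            have h3 : p ∣ ((hTuple k x j : ℤ) - hTuple k x i).natAbs := Int.natCast_dvd.1 hdvd
            exact hpp.one_lt.ne' (Nat.Coprime.eq_one_of_dvd h2 h3)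
          have h2 := logpow_mul_QformP_le_of_pattern hD hδ0 hx1 hlogx hlogy hyx hm hp₀ hxp hcop hacop
            hpp hc hpx hpk hpm hph hCd0 (fun S T hS hT =>
              (hx₂ i m p₀ hm hmx hp₀ hxp hp₀x hcop p hlogp S T hS hT).trans
                (mul_le_mul_of_nonneg_right (hC₂le i) hSN0.le))
          rw [hRdef, div_mul_eq_mul_div, le_div_iff₀ hLL0, mul_comm]
          refine h2.trans (le_of_eq ?_)
          rw [show (16 : ℝ) ^ k = 4 ^ k * 4 ^ k by rw [← mul_pow]; norm_num]
          ring
        · -- the window: the trivial bound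
          have hlog1 : Real.log ((1 : ℕ) : ℝ) ≤ (1 - 1 / 2) * Real.log (y ε x) := by
            rw [Nat.cast_one, Real.log_one]; positivity
          have h2 := logpow_mul_QformP_le_of_trivial hD hx1 hlogx hlogy hm hp₀ hxp hcop hacop hpp hc
            hpx ((hx₁ i m p₀ hm hmx hp₀ hxp hp₀x hcop 1 hlog1 ∅ ∅ (by simp) (by simp)).trans
              (mul_le_mul_of_nonneg_right (hC₁le i) hSN0.le))
          rw [hRdef, div_mul_eq_mul_div, le_div_iff₀ hLL0, mul_comm]
          refine h2.trans (le_of_eq ?_)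
          ring
      calc _ ≤ _ := h1
        _ ≤ N * (R * g p) + err p := by
            simp only [herrdef]
            gcongr
  -- summing the per-`p` step
  have hcorr : classCorr cj Fd G ε x m p₀ i A' B' ≤
      ∑ ab : Fin k × Fin k, ∑ p ∈ (midPrimes ε x).filter (fun p => ¬ p ∣ m),
        (1 / (p : ℝ)) * (N * (R * g p) + err p) := by
    unfold classCorr
    refine Finset.sum_le_sum fun ab _ => Finset.sum_le_sum fun p hp => ?_
    exact mul_le_mul_of_nonneg_left (hstep p hp ab) (by positivity)
  have hsplit : ∑ ab : Fin k × Fin k, ∑ p ∈ (midPrimes ε x).filter (fun p => ¬ p ∣ m),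
        (1 / (p : ℝ)) * (N * (R * g p) + err p) =
      (k : ℝ) ^ 2 * (N * R * ∑ p ∈ (midPrimes ε x).filter (fun p => ¬ p ∣ m), g p / p +
        ∑ p ∈ (midPrimes ε x).filter (fun p => ¬ p ∣ m), (1 / (p : ℝ)) * err p) := by
    have h1 : ∑ p ∈ (midPrimes ε x).filter (fun p => ¬ p ∣ m),
        (1 / (p : ℝ)) * (N * (R * g p) + err p) =
        N * R * ∑ p ∈ (midPrimes ε x).filter (fun p => ¬ p ∣ m), g p / p +
          ∑ p ∈ (midPrimes ε x).filter (fun p => ¬ p ∣ m), (1 / (p : ℝ)) * err p := by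
      rw [Finset.mul_sum, ← Finset.sum_add_distrib]
      exact Finset.sum_congr rfl fun p _ => by ring
    rw [Finset.sum_const, Finset.card_univ, Fintype.card_prod, Fintype.card_fin, nsmul_eq_mul, h1]
    push_cast
    ring
  -- the error terms
  have herrsum : ∑ p ∈ (midPrimes ε x).filter (fun p => ¬ p ∣ m), (1 / (p : ℝ)) * err p ≤
      Ce * x / Real.log x ^ A :=
    hxe i _ fun p hp => ⟨(midPrime_facts hy0.le hyx hp).1, (midPrime_facts hy0.le hyx hp).2.2.2.2.1⟩
  -- the main coefficients
  have hgsum : ∑ p ∈ (midPrimes ε x).filter (fun p => ¬ p ∣ m), g p / p ≤ η / (k : ℝ) ^ 2 := by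
    have hterm : ∀ p ∈ (midPrimes ε x).filter (fun p => ¬ p ∣ m), g p / p ≤
        2 * 16 ^ k * Cd * (1 / ((p : ℝ) * ((p : ℝ) - 1))) +
          Ch * (if y ε x ^ (1 - δ) < (p : ℝ) then 1 / (p : ℝ) else 0) := by
      intro p hp
      have hpp := (midPrime_facts hy0.le hyx hp).1
      have hp2 : (2 : ℝ) ≤ p := by exact_mod_cast hpp.two_le
      have hpp0 : (0 : ℝ) < (p : ℝ) * ((p : ℝ) - 1) := by nlinarith
      have hfirst : 0 ≤ 2 * 16 ^ k * Cd * (1 / ((p : ℝ) * ((p : ℝ) - 1))) := by positivity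
      simp only [hgdef]
      split_ifs with h1 h2 h2
      · exfalso; linarith
      · rw [mul_zero, add_zero]
        refine le_of_eq ?_
        rw [div_div, mul_one_div, mul_comm ((p : ℝ) - 1)]
      · rw [mul_one_div Ch]
        linarith
      · exfalso; exact h2 (not_le.1 h1)
    have hS1 : ∑ p ∈ (midPrimes ε x).filter (fun p => ¬ p ∣ m), (1 : ℝ) / ((p : ℝ) * ((p : ℝ) - 1)) ≤
        1 / ⌊wFun x⌋₊ := by
      refine (Finset.sum_le_sum_of_subset_of_nonneg (Finset.filter_subset _ _) fun p hp _ => ?_).trans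
        (sum_midPrimes_inv_mul_le hw1)
      have hp2 : (2 : ℝ) ≤ p := by
        rw [midPrimes, Finset.mem_filter] at hp
        exact_mod_cast hp.2.two_le
      have : (0 : ℝ) < (p : ℝ) * ((p : ℝ) - 1) := by nlinarith
      positivity
    have hexpM : Real.exp M ≤ y ε x ^ (1 - δ) := by
      rw [Real.rpow_def_of_pos hy0, Real.exp_le_exp]
      nlinarith
    have hS2 : ∑ p ∈ (midPrimes ε x).filter (fun p => ¬ p ∣ m),
        (if y ε x ^ (1 - δ) < (p : ℝ) then 1 / (p : ℝ) else 0) ≤ 2.1444 * δ + 25 / M := by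
      rw [← Finset.sum_filter]
      refine (Finset.sum_le_sum_of_subset_of_nonneg ?_ fun p _ _ => by positivity).trans
        (sum_inv_primes_rpow_window_le hy1 hδ0.le hδh hM10 hexpM)
      intro p hp
      rw [Finset.mem_filter] at hp
      obtain ⟨hpp, -, -, -, -, -, hpyf⟩ := midPrime_facts hy0.le hyx hp.1
      rw [Finset.mem_filter, Finset.mem_Ioc]
      exact ⟨⟨(Nat.floor_lt (Real.rpow_nonneg hy0.le _)).2 hp.2, hpyf⟩, hpp⟩
    calc ∑ p ∈ (midPrimes ε x).filter (fun p => ¬ p ∣ m), g p / p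
        ≤ ∑ p ∈ (midPrimes ε x).filter (fun p => ¬ p ∣ m),
            (2 * 16 ^ k * Cd * (1 / ((p : ℝ) * ((p : ℝ) - 1))) +
              Ch * (if y ε x ^ (1 - δ) < (p : ℝ) then 1 / (p : ℝ) else 0)) := Finset.sum_le_sum hterm
      _ = 2 * 16 ^ k * Cd *
            ∑ p ∈ (midPrimes ε x).filter (fun p => ¬ p ∣ m), (1 : ℝ) / ((p : ℝ) * ((p : ℝ) - 1)) +
          Ch * ∑ p ∈ (midPrimes ε x).filter (fun p => ¬ p ∣ m),
            (if y ε x ^ (1 - δ) < (p : ℝ) then 1 / (p : ℝ) else 0) := by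
          rw [Finset.sum_add_distrib, ← Finset.mul_sum, ← Finset.mul_sum]
      _ ≤ 2 * 16 ^ k * Cd * (1 / ⌊wFun x⌋₊) + Ch * (2.1444 * δ + 25 / M) :=
          add_le_add (mul_le_mul_of_nonneg_left hS1 (by positivity))
            (mul_le_mul_of_nonneg_left hS2 hCh0)
      _ ≤ η / (k : ℝ) ^ 2 := numeric_closure hk hη hCh0 hCd0 hδ0.le hδη hMη hwfloor
  -- conclusion
  calc classCorr cj Fd G ε x m p₀ i A' B'
      ≤ _ := hcorr
    _ = _ := hsplit
    _ ≤ (k : ℝ) ^ 2 * (N * R * (η / (k : ℝ) ^ 2) + Ce * x / Real.log x ^ A) := by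
        gcongr
    _ = η * N * SN / LL + (k : ℝ) ^ 2 * Ce * x / Real.log x ^ A := by
        rw [hRdef]
        field_simp
    _ = _ := by rw [hNdef, hSNdef, hLLdef]

/-- `Lemma7ClassMoment` — `_holds` alias of `lemma7ClassMoment_holds` above under the fact's exact name (appended
2026-08-28, D-0026 bookkeeping: the proof term is the existing theorem of this file; no statement,
definition or attribute is edited; no new named fact; the ledger's debt table listed the fact
unproved). [cite: Maynard2016LargeGaps, Lemma 7 (proof, before (6.33))] -/
theorem _root_.Literature.NumberTheory.Sieve.Maynard2016.Lemma7ClassMoment_holds :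
    Lemma7ClassMoment :=
  _root_.Literature.NumberTheory.Sieve.Maynard2016.lemma7ClassMoment_holds

end Maynard2016

end Literature.NumberTheory.Sieve

end
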